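import Literature.AlgebraicGeometry.Resolution.RegularCentreRsopPart
import Literature.RingTheory.RegularLocalRing.QuotientDVR
import HarnessLib

/-!
# [OURS · L1 W4.5(b) · EL♮(3)] Rung TOWER, (pt-ram) supplier — RING BRICK: a PRESCRIBED curvilinear fat point trace is the trace
# of a regular multisection (crux `EquisingularLiftNatThree` = stmt-ResolutionOfSingularities-20148 / `EquisingularLiftNat` = stmt-…-20038)

HONEST FRAMING. OURS (cell res-hironaka, crux chain w45b, slot W4.5(b)); NOT a statement of any manuscript; AI-written, weaker than
expert review. Helper `--supports stmt-ResolutionOfSingularities-20148 --as helper`; closes nothing. Object = the ring core of the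
UPSTAIRS SUPPLIER of the (pt-ram) step of rung TOWER (res-L1-w45b-lead-2 g2, `…NatTowerDefs` p541504, `TowerPtRam`; PLANNER-MEMO-g11-1
§2–§3, res-L1-w45b-plan-1 g11): downstairs the centre of a (pt-ram) step is an ideal `J` supported at a point `y` of the special fibre
`G` whose stalk `J_y = (ℓ₁, ℓ₂, ℓ₃)` has generators with LINEARLY INDEPENDENT classes in `𝔪_{G,y}/𝔪_{G,y}²`; upstairs one needs a
prime `𝔭 ⊂ 𝒪_{P,y}` with DVR quotient, `ϖ ∉ 𝔭` and `𝔭·𝒪_G = J_y`, to feed res-D-pv-003's `multisection_of_prime` (p509091, T-MULTISEC)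
— which then yields the regular `O`-flat multisection `C = V(primeDivisorIdeal)` with `stalkIdeal C y = 𝔭`. This file is that prime, for a
PRESCRIBED cotangent-independent family (T-MULTISEC's own ring brick `exists_isPrime_isDiscreteValuationRing_quotient_not_mem`, p507664-class,
constructs SOME prime; here the trace is given).

CONTENT (pure commutative algebra, no scheme):
* `isRsopPart_of_linearIndependent_toCotangent` — cotangent-independent elements of `𝔪` are part of a regular system of parameters
  (`exists_extend_to_rsop`, tree);
* `isDiscreteValuationRing_quotient_span_range` — in a regular local ring of dimension `d + 1`, `d` cotangent-independent elements `f`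
  generate a PRIME `𝔭 = (f)` with `R ⧸ 𝔭` a DISCRETE VALUATION RING (`IsRsopPart.ringKrullDim_quotient_add` + Matsumura 11.2);
* `not_mem_span_range_of_maximalIdeal_pow_le` — if moreover `𝔪^N ⊆ (f) + (ϖ)` for some `N` («the trace `(f)·R/(ϖ)` is `𝔪`-primary»,
  i.e. `supp J = {y}` downstairs) then `ϖ ∉ 𝔭` (else `𝔭 = 𝔪`, but `R ⧸ 𝔭` is not a field) — so the multisection is HORIZONTAL;
* `forall_mem_maximalIdeal_of_map` — TRANSFER of cotangent-independence along a local homomorphism `π : R → A` (the special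
  fibre `A = 𝒪_{G,y} = 𝒪_{P,y}/(ϖ)`): if the images `π ∘ f` are cotangent-independent in `A` (∀-form of
  `linearIndependent_toCotangent_iff_forall_mem`) then `f` is cotangent-independent in `R` — no hypothesis `ϖ ∈ 𝔪²` needed for this direction.
Mathlib / tree searched: `IsRsopPart` (`RsopMonomialIdeals`), `exists_extend_to_rsop` (`StrictNormalCrossingsDescent`),
`linearIndependent_toCotangent_iff_forall_mem` (`StrictNormalCrossingsAt`), `isDiscreteValuationRing_of_ringKrullDim_eq_one` (`QuotientDVR`),
`isRegularLocalRing_quotient_span_range` (`CobordantBlowupRegularCentre`, regularity only — the dimension count is what this file adds).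

References: H. Matsumura, *Commutative Ring Theory* (1986), Thm. 14.2, Thm. 11.2 [Matsumura1987] — through the cited tree files.
-/

set_option linter.dupNamespace false -- mandated namespace `Summit.<Summit>.<Problem>` of this single-conjunct summit

universe u

open IsLocalRing
open Literature.AlgebraicGeometry.Resolution Literature.RingTheory.RegularLocalRing

namespace Summit.ResolutionOfSingularities.ResolutionOfSingularities.Cruxes.EquisingularLiftNat.Sections

/-- **Cotangent-independent elements of `𝔪` are part of a regular system of parameters** of a regular local ring. [folklore;
Matsumura1987 Thm. 14.2, via the tree's `exists_extend_to_rsop`] -/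
theorem isRsopPart_of_linearIndependent_toCotangent {R : Type u} [CommRing R] [IsRegularLocalRing R] {k : ℕ}
    (f : Fin k → R) (hf : ∀ i, f i ∈ maximalIdeal R)
    (hli : LinearIndependent (ResidueField R) fun i => (maximalIdeal R).toCotangent ⟨f i, hf i⟩) :
    IsRsopPart f := by
  have hind := (linearIndependent_toCotangent_iff_forall_mem f hf).mp hli
  obtain ⟨e, y, hdim, hspan⟩ := exists_extend_to_rsop f hf hind
  exact ⟨inferInstance, e, y, hdim, hspan⟩

/-- **`d` cotangent-independent elements of a regular local ring of dimension `d + 1` generate a prime with DVR quotient.**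
[folklore; Matsumura1987 Thm. 14.2 + Thm. 11.2] -/
theorem isDiscreteValuationRing_quotient_span_range {R : Type u} [CommRing R] [IsRegularLocalRing R] {d : ℕ}
    (hd : ringKrullDim R = (d + 1 : ℕ)) (f : Fin d → R) (hf : ∀ i, f i ∈ maximalIdeal R)
    (hli : LinearIndependent (ResidueField R) fun i => (maximalIdeal R).toCotangent ⟨f i, hf i⟩) :
    (Ideal.span (Set.range f)).IsPrime ∧
      ∃ _ : IsDomain (R ⧸ Ideal.span (Set.range f)), IsDiscreteValuationRing (R ⧸ Ideal.span (Set.range f)) := by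
  have hz := isRsopPart_of_linearIndependent_toCotangent f hf hli
  haveI hreg : IsRegularLocalRing (R ⧸ Ideal.span (Set.range f)) := hz.isRegularLocalRing_quotient
  haveI : IsDomain (R ⧸ Ideal.span (Set.range f)) := isDomain_of_isRegularLocalRing _
  have hadd := hz.ringKrullDim_quotient_add
  rw [hd] at hadd
  -- `dim (R/𝔭) + d = d + 1` ⇒ `dim (R/𝔭) = 1`
  have h1 : ringKrullDim (R ⧸ Ideal.span (Set.range f)) = 1 := by
    obtain ⟨m, hm⟩ := exists_nat_cast_eq_ringKrullDim (R := R ⧸ Ideal.span (Set.range f))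
    rw [hm] at hadd ⊢
    have hmd : ((m + d : ℕ) : WithBot ℕ∞) = ((d + 1 : ℕ) : WithBot ℕ∞) := by
      rw [← hadd]; push_cast; rfl
    have : m + d = d + 1 := by exact_mod_cast hmd
    have hm1 : m = 1 := by omega
    subst hm1
    rfl
  exact ⟨hz.isPrime_span_range, inferInstance, isDiscreteValuationRing_of_ringKrullDim_eq_one h1⟩

/-- **Horizontality**: with `f` as above, if `𝔪^N ⊆ (f) + (ϖ)` for some `N` (downstairs: the trace of `(f)` on the special fibre
`R/(ϖ)` is `𝔪`-primary, i.e. the fat point is supported at the closed point only), then `ϖ ∉ (f)` — the multisection `V(f)` is not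
contained in the special fibre `ϖ = 0`. [folklore] -/
theorem not_mem_span_range_of_maximalIdeal_pow_le {R : Type u} [CommRing R] [IsRegularLocalRing R] {d : ℕ}
    (hd : ringKrullDim R = (d + 1 : ℕ)) (f : Fin d → R) (hf : ∀ i, f i ∈ maximalIdeal R)
    (hli : LinearIndependent (ResidueField R) fun i => (maximalIdeal R).toCotangent ⟨f i, hf i⟩)
    {ϖ : R} {N : ℕ} (hN : maximalIdeal R ^ N ≤ Ideal.span (Set.range f) ⊔ Ideal.span {ϖ}) :
    ϖ ∉ Ideal.span (Set.range f) := by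
  intro hϖ
  obtain ⟨hprime, hdom, hdvr⟩ := isDiscreteValuationRing_quotient_span_range hd f hf hli
  -- `(f) + (ϖ) = (f)` hence `𝔪^N ≤ (f)`, and `(f)` prime ⇒ `𝔪 ≤ (f)` ⇒ `(f) = 𝔪`
  have hsup : Ideal.span (Set.range f) ⊔ Ideal.span {ϖ} = Ideal.span (Set.range f) :=
    sup_eq_left.mpr ((Ideal.span_singleton_le_iff_mem _).mpr hϖ)
  rw [hsup] at hN
  haveI := hprime
  have hle' : Ideal.span (Set.range f) ≤ maximalIdeal R := by
    rw [Ideal.span_le]; rintro _ ⟨i, rfl⟩; exact hf i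
  -- `N ≠ 0` (else `⊤ ≤ (f)`), then `𝔪 ≤ (f)` by primality
  have hN0 : N ≠ 0 := by
    rintro rfl
    rw [pow_zero, Ideal.one_eq_top, top_le_iff] at hN
    exact hprime.ne_top hN
  have hle : maximalIdeal R ≤ Ideal.span (Set.range f) := (Ideal.IsPrime.pow_le_iff hN0).mp hN
  have heq : Ideal.span (Set.range f) = maximalIdeal R := le_antisymm hle' hle
  -- then `R ⧸ (f)` is a field, contradicting `not_a_field'`
  have hmax : (Ideal.span (Set.range f)).IsMaximal := heq ▸ maximalIdeal.isMaximal R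
  have hfield : IsField (R ⧸ Ideal.span (Set.range f)) :=
    (Ideal.Quotient.maximal_ideal_iff_isField_quotient _).mp hmax
  haveI := hdom
  have hbot : maximalIdeal (R ⧸ Ideal.span (Set.range f)) = ⊥ := (isField_iff_maximalIdeal_eq).mp hfield
  exact IsDiscreteValuationRing.not_a_field (R := R ⧸ Ideal.span (Set.range f)) hbot

/-- **Transfer of cotangent-independence along a local homomorphism** (∀-form of `linearIndependent_toCotangent_iff_forall_mem`):
if `π : R → A` is a local ring homomorphism of local rings (e.g. `A = R/(ϖ)`, the special fibre) and the images `π (f i)` are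
cotangent-independent in `A`, then the `f i` are cotangent-independent in `R` (no surjectivity and no `ϖ ∈ 𝔪²` needed for this
direction). [folklore] -/
theorem forall_mem_maximalIdeal_of_map {R A : Type u} [CommRing R] [IsLocalRing R] [CommRing A] [IsLocalRing A]
    (π : R →+* A) [IsLocalHom π] {k : ℕ} (f : Fin k → R)
    (hind : ∀ c : Fin k → A, ∑ i, c i * π (f i) ∈ (maximalIdeal A) ^ 2 → ∀ i, c i ∈ maximalIdeal A) :
    ∀ c : Fin k → R, ∑ i, c i * f i ∈ (maximalIdeal R) ^ 2 → ∀ i, c i ∈ maximalIdeal R := by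
  intro c hc i
  have hmap : (maximalIdeal R).map π ≤ maximalIdeal A := by
    rw [Ideal.map_le_iff_le_comap]
    exact fun a ha => (IsLocalRing.mem_maximalIdeal _).mpr
      (fun hu => ((IsLocalRing.mem_maximalIdeal _).mp ha) (isUnit_of_map_unit π a hu))
  have hc' : ∑ j, π (c j) * π (f j) ∈ (maximalIdeal A) ^ 2 := by
    have h := Ideal.mem_map_of_mem π hc
    rw [map_sum] at h
    simp only [map_mul] at h
    rw [Ideal.map_pow] at h
    exact Ideal.pow_right_mono hmap 2 h
  have hi := hind (fun j => π (c j)) hc' i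
  exact (IsLocalRing.mem_maximalIdeal _).mpr (fun hu => ((IsLocalRing.mem_maximalIdeal _).mp hi) (hu.map π))

end Summit.ResolutionOfSingularities.ResolutionOfSingularities.Cruxes.EquisingularLiftNat.Sections
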